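import Summits.Ventures.LatticeQCDFlow.Scaling.AcceptanceModelLipschitz
import Summits.Ventures.LatticeQCDFlow.Scoring.IMHAutocorrelationEnvelope
import HarnessLib

/-!
# LatticeQCDFlow / Scaling — what a NON-uniform density parity certifies: the acceptance column yes, the `τ_int` column no

HONEST FRAMING: exact (Metropolis-corrected) sampling algorithms for lattice gauge theory;
figures of merit are autocorrelation/cost numbers at stated couplings and volumes; no
continuum-physics claim.

Venture `LatticeQCDFlow` (cell pub-lqcd), topic `Scaling`; FANOUT row 4 (`s0-u1-b`, rung S0-B
implementation B: an independent code path for the 2D U(1) flow, compared with implementation A by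
'acceptance A vs B within 3 pp at every β; τ_int(Q) A vs B within 1σ_comb').  NEW WORK of the
cell — elementary finite sums over the tree's `Scaling/AcceptanceTransfer.lean`
(`abs_accRate_sub_accRate_le_two_mul_tvDist_right`: the stationary acceptance is 2-Lipschitz in
the model law), `Scaling/AcceptanceModelLipschitz.lean` (`accRate_self_eq_one`) and
`Scoring/IMHAutocorrelationEnvelope.lean` (`tauInt_acfA_mode_eq`: the indicator of the heaviest
state of the exact flow-MCMC chain has `τ_int = w⋆ − 1/2` exactly); nothing is cited as a fact, no
definition is introduced.  Finite state space `X`; `p` the target (a probability vector), `q`, `q'`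
two positive model laws; `accRate p q = Σ_x Σ_y min (p x · q y) (p y · q x)`
(`Exactness/FlowMCMC.lean`); `tvDist` (`Literature/Probability/MarkovChains/TotalVariation.lean`);
`Scoring.acfA p q A` the normalised autocorrelation function of the indicator of the sector `A`
along the exact chain `imhKernel p q` at stationarity and `Scoring.tauInt` its integrated
autocorrelation time (`Scoring/StickingFloorExact.lean`, `Scoring/CalibrationTruths.lean`).

## Why (row 4, value-free)

The two companions of this file treat the two columns of row 4's test under a UNIFORM (sup-norm)
log-density parity `|log q − log q'| ≤ δ` between two codes evaluating the same trained weights: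
the acceptances then agree to `e^δ − 1` (`Theory2.abs_accRate_sub_le_exp_sub_one`) and, for every
bounded observable, `|τ − τ'| ≤ (e^δ − 1)(τ + ½)` (`Exactness.imhOp_tauInt_sub_le_of_logParity`).
A parity MEASURED on finitely many common draws is not a sup-norm statement: it leaves an
exceptional set `E` of configurations on which nothing is known, small only in the law the draws
came from.  This file records what survives.

## What is proved

* §1 ACCEPTANCE NEEDS PARITY ONLY IN MODEL PROBABILITY.  `abs_sub_le_exp_sub_one_mul_of_abs_log_sub_le`
  (pointwise: `|log a − log b| ≤ δ ⇒ |a − b| ≤ (e^δ − 1)·a`); **`two_mul_tvDist_le_of_logParityOff`**: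
  if `|log q x − log q' x| ≤ δ` for every `x ∉ E` then
  `2‖q − q'‖_TV ≤ (e^δ − 1)·q(Eᶜ) + q(E) + q'(E)`; hence **`abs_accRate_sub_le_of_logParityOff`**:
  `|acc(p, q) − acc(p, q')| ≤ (e^δ − 1)·q(Eᶜ) + q(E) + q'(E) ≤ (e^δ − 1) + q(E) + q'(E)`
  (`abs_accRate_sub_le_exp_sub_one_add_mass`) — an exceptional set of small mass under BOTH models
  moves the stationary acceptance by at most that mass, whatever happens on it and whatever its
  target mass.
* §2 THE `τ_int` COLUMN HAS NO SUCH LAW — an explicit two-point family.  Target `p = (1 − ε, ε)`,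
  model A `q = p` (a perfect model), model B `q' = (1 − εη, εη)` (`0 < ε < 1`, `0 < η ≤ 1`): the
  exceptional set is the single state `1`, of target mass `ε` and model masses `q(1) = ε`,
  `q'(1) = εη ≤ ε`; off it the parity holds to `δ = log((1 − εη)/(1 − ε)) ≤ −log(1 − ε)`
  (`abs_log_parityWitness_off_le`); `‖q − q'‖_TV = ε(1 − η)` (`tvDist_parityWitness`);
  `acc(p, q) = 1`, `acc(p, q') = 1 − ε(1 − η)` (`accRate_parityWitness`) — so the acceptance column
  moves by `ε(1 − η) ≤ ε`, inside §1's allowance `q(E) + q'(E) + (e^δ − 1)`; but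
  **`tauInt_acfA_parityWitness_self`**: `τ_int(1_{1}; p, q) = 1/2` and
  **`tauInt_acfA_parityWitness`**: `τ_int(1_{1}; p, q') = 1/η − 1/2`.  Hence
  **`exists_tauInt_gap_of_logParityOff`**: for every `ε ∈ (0, 1)` and every `M` there are a target
  and two positive models on two points, at parity `≤ −log(1 − ε)` off one state whose mass is
  `≤ ε` under the target and under both models, with `‖q − q'‖_TV ≤ ε` and
  `|acc(p, q) − acc(p, q')| ≤ ε`, such that `τ_int` of that state's indicator is `1/2` for one
  model and `≥ M` for the other.

Reading for row 4's A-vs-B table (no number of ours, no sealed value): a density parity checked on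
`N` common MODEL draws bounds the exceptional set only in model probability (`q(E), q'(E) ≲ 1/N`
at best), which by §1 is exactly what the ACCEPTANCE column needs — that column is certified by
such a check up to `≈ q(E) + q'(E) + (e^δ − 1)` plus Monte-Carlo error.  By §2 the same check
certifies NOTHING about the `τ_int` column: the population `τ_int` of a sector indicator is
`p(E)/q'(E) − 1/2` on the witness, driven by the ratio of target to model mass on the exceptional
set, which model draws do not see (`Scaling/Blindness.lean` is the i.i.d. form of the same
blindness).  The `τ` column is pinned by parity only if the parity is UNIFORM
(`Exactness.imhOp_tauInt_logParity_sandwich`) or at least one-sided with a known floor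
(`Exactness.imhOp_tauInt_le_of_model_ge`); a parity check aimed at the `τ` column belongs on
TARGET-distributed configurations (the accepted chain), where the exceptional set of the witness
has mass `ε`, not `εη`.  NOT CLAIMED: any statement about which law the legs of AGREEMENT-AB drew
from; HMC / local Metropolis; unbounded observables; any number re-scored.
-/

namespace Summit.Ventures.LatticeQCDFlow.Theory2.DensityParity

open Finset
open Literature.Probability.MarkovChains
open Summit.Ventures.LatticeQCDFlow.Exactness
open Summit.Ventures.LatticeQCDFlow.Scoring

variable {X : Type*} [Fintype X]

/-! ### §1 Acceptance needs parity only in model probability -/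

section Acceptance

variable [DecidableEq X]

/-- Pointwise parity-to-difference: for `a, b > 0` with `|log a − log b| ≤ δ`,
`|a − b| ≤ (e^δ − 1)·a`. [folklore] -/
theorem abs_sub_le_exp_sub_one_mul_of_abs_log_sub_le {a b δ : ℝ} (ha : 0 < a) (hb : 0 < b)
    (h : |Real.log a - Real.log b| ≤ δ) : |a - b| ≤ (Real.exp δ - 1) * a := by
  have hδ : 0 ≤ δ := (abs_nonneg _).trans h
  have he : 0 ≤ Real.exp δ - 1 := by linarith [Real.add_one_le_exp δ]
  rw [abs_sub_le_iff] at h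
  -- `b ≤ e^δ · a` and `a ≤ e^δ · b`
  have h1 : b ≤ Real.exp δ * a := by
    have : Real.log b ≤ δ + Real.log a := by linarith [h.2]
    calc b = Real.exp (Real.log b) := (Real.exp_log hb).symm
      _ ≤ Real.exp (δ + Real.log a) := Real.exp_le_exp.2 this
      _ = Real.exp δ * a := by rw [Real.exp_add, Real.exp_log ha]
  have h2 : a ≤ Real.exp δ * b := by
    have : Real.log a ≤ δ + Real.log b := by linarith [h.1]
    calc a = Real.exp (Real.log a) := (Real.exp_log ha).symm
      _ ≤ Real.exp (δ + Real.log b) := Real.exp_le_exp.2 this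
      _ = Real.exp δ * b := by rw [Real.exp_add, Real.exp_log hb]
  rcases le_total a b with hab | hba
  · rw [abs_of_nonpos (sub_nonpos.2 hab)]
    linarith
  · rw [abs_of_nonneg (sub_nonneg.2 hba)]
    have h3 : (Real.exp δ - 1) * b ≤ (Real.exp δ - 1) * a := mul_le_mul_of_nonneg_left hba he
    linarith

/-- **`2‖q − q'‖_TV ≤ (e^δ − 1)·q(Eᶜ) + q(E) + q'(E)`** for positive laws agreeing to `δ` in log
OFF the exceptional set `E` (nothing assumed on `E`). [folklore] -/
theorem two_mul_tvDist_le_of_logParityOff {q q' : X → ℝ} (hq : ∀ x, 0 < q x) (hq' : ∀ x, 0 < q' x)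
    (E : Finset X) {δ : ℝ} (hlog : ∀ x, x ∉ E → |Real.log (q x) - Real.log (q' x)| ≤ δ) :
    2 * tvDist q q' ≤
      (Real.exp δ - 1) * (∑ x ∈ univ \ E, q x) + (∑ x ∈ E, q x + ∑ x ∈ E, q' x) := by
  unfold tvDist
  rw [← mul_assoc, show (2 : ℝ) * (1 / 2) = 1 by norm_num, one_mul,
    ← sum_sdiff (subset_univ E)]
  refine add_le_add ?_ ?_
  · rw [mul_sum]
    refine sum_le_sum fun x hx => ?_
    have hxE : x ∉ E := (mem_sdiff.1 hx).2
    exact abs_sub_le_exp_sub_one_mul_of_abs_log_sub_le (hq x) (hq' x) (hlog x hxE)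
  · rw [← sum_add_distrib]
    refine sum_le_sum fun x _ => ?_
    have h1 := hq x
    have h2 := hq' x
    rw [abs_sub_le_iff]
    constructor <;> linarith

/-- **Acceptance needs parity only in model probability.**  At one target `p` (a probability
vector), two positive model laws `q`, `q'` (probability vectors) that agree to `δ` in log off an
exceptional set `E` have stationary acceptances within
`(e^δ − 1)·q(Eᶜ) + q(E) + q'(E)` — whatever the densities do on `E` and whatever `p(E)` is.
[folklore] -/
theorem abs_accRate_sub_le_of_logParityOff {p q q' : X → ℝ} (hp : ∀ x, 0 ≤ p x)
    (hp1 : ∑ x, p x = 1) (hq : ∀ x, 0 < q x) (hq' : ∀ x, 0 < q' x) (hq1 : ∑ x, q x = 1)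
    (hq1' : ∑ x, q' x = 1) (E : Finset X) {δ : ℝ}
    (hlog : ∀ x, x ∉ E → |Real.log (q x) - Real.log (q' x)| ≤ δ) :
    |accRate p q - accRate p q'| ≤
      (Real.exp δ - 1) * (∑ x ∈ univ \ E, q x) + (∑ x ∈ E, q x + ∑ x ∈ E, q' x) :=
  (abs_accRate_sub_accRate_le_two_mul_tvDist_right hp hp1 hq1 hq1').trans
    (two_mul_tvDist_le_of_logParityOff hq hq' E hlog)

/-- Simplified form: for `δ ≥ 0`, `|acc(p, q) − acc(p, q')| ≤ (e^δ − 1) + q(E) + q'(E)`.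
[folklore] -/
theorem abs_accRate_sub_le_exp_sub_one_add_mass {p q q' : X → ℝ} (hp : ∀ x, 0 ≤ p x)
    (hp1 : ∑ x, p x = 1) (hq : ∀ x, 0 < q x) (hq' : ∀ x, 0 < q' x) (hq1 : ∑ x, q x = 1)
    (hq1' : ∑ x, q' x = 1) (E : Finset X) {δ : ℝ} (hδ : 0 ≤ δ)
    (hlog : ∀ x, x ∉ E → |Real.log (q x) - Real.log (q' x)| ≤ δ) :
    |accRate p q - accRate p q'| ≤ (Real.exp δ - 1) + (∑ x ∈ E, q x + ∑ x ∈ E, q' x) := by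
  refine (abs_accRate_sub_le_of_logParityOff hp hp1 hq hq' hq1 hq1' E hlog).trans
    (add_le_add ?_ le_rfl)
  have he : 0 ≤ Real.exp δ - 1 := by linarith [Real.add_one_le_exp δ]
  have hle : ∑ x ∈ univ \ E, q x ≤ 1 :=
    calc ∑ x ∈ univ \ E, q x ≤ ∑ x, q x :=
          sum_le_sum_of_subset_of_nonneg (subset_univ _) fun x _ _ => (hq x).le
      _ = 1 := hq1
  calc (Real.exp δ - 1) * ∑ x ∈ univ \ E, q x ≤ (Real.exp δ - 1) * 1 :=
        mul_le_mul_of_nonneg_left hle he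
    _ = Real.exp δ - 1 := mul_one _

end Acceptance

/-! ### §2 The `τ_int` column: an explicit two-point family with bounded parity defect and unbounded `τ` gap -/

section TauInt

/-- The two-point laws `(1 − a, a)` have unit mass. -/
theorem sum_parityWitness (a : ℝ) : ∑ i, (![1 - a, a] : Fin 2 → ℝ) i = 1 := by
  rw [Fin.sum_univ_two]
  simp only [Matrix.cons_val_zero, Matrix.cons_val_one]
  ring

/-- The two-point laws `(1 − a, a)` are positive for `0 < a < 1`. -/
theorem parityWitness_pos {a : ℝ} (ha0 : 0 < a) (ha1 : a < 1) (i : Fin 2) :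
    0 < (![1 - a, a] : Fin 2 → ℝ) i := by
  fin_cases i
  · show 0 < 1 - a
    linarith
  · exact ha0

/-- `‖(1 − ε, ε) − (1 − εη, εη)‖_TV = ε(1 − η)` for `0 ≤ ε`, `η ≤ 1`. -/
theorem tvDist_parityWitness {ε η : ℝ} (hε : 0 ≤ ε) (hη : η ≤ 1) :
    tvDist (![1 - ε, ε] : Fin 2 → ℝ) ![1 - ε * η, ε * η] = ε * (1 - η) := by
  unfold tvDist
  rw [Fin.sum_univ_two]
  simp only [Matrix.cons_val_zero, Matrix.cons_val_one]
  have h0 : 0 ≤ ε * (1 - η) := mul_nonneg hε (by linarith)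
  have h1 : |1 - ε - (1 - ε * η)| = ε * (1 - η) := by
    rw [show 1 - ε - (1 - ε * η) = -(ε * (1 - η)) by ring, abs_neg, abs_of_nonneg h0]
  have h2 : |ε - ε * η| = ε * (1 - η) := by
    rw [show ε - ε * η = ε * (1 - η) by ring, abs_of_nonneg h0]
  rw [h1, h2]
  ring

/-- The stationary acceptance of model B at the two-point target:
`acc((1 − ε, ε), (1 − εη, εη)) = 1 − ε(1 − η)` for `0 ≤ ε`, `η ≤ 1` — it equals
`1 − ‖p − q'‖_TV`, the ceiling of `Exactness.accRate_le`. -/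
theorem accRate_parityWitness {ε η : ℝ} (hε : 0 ≤ ε) (hη1 : η ≤ 1) :
    accRate (![1 - ε, ε] : Fin 2 → ℝ) ![1 - ε * η, ε * η] = 1 - ε * (1 - η) := by
  unfold accRate
  simp only [Fin.sum_univ_two, Matrix.cons_val_zero, Matrix.cons_val_one, min_self]
  -- the two off-diagonal minima: `(1 − ε)·εη ≤ ε·(1 − εη)` since `η(1 − ε) ≤ 1 − εη`
  have key : (1 - ε) * (ε * η) ≤ ε * (1 - ε * η) := by nlinarith
  rw [min_eq_left key, min_eq_right key]
  ring

/-- Off the exceptional state the parity defect of the witness is small: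
`|log(1 − ε) − log(1 − εη)| ≤ −log(1 − ε)` for `0 ≤ ε < 1`, `0 ≤ η ≤ 1`. -/
theorem abs_log_parityWitness_off_le {ε η : ℝ} (hε : 0 ≤ ε) (hε1 : ε < 1) (hη : 0 ≤ η)
    (hη1 : η ≤ 1) :
    |Real.log ((![1 - ε, ε] : Fin 2 → ℝ) 0) - Real.log ((![1 - ε * η, ε * η] : Fin 2 → ℝ) 0)| ≤
      -Real.log (1 - ε) := by
  simp only [Matrix.cons_val_zero]
  have h1 : 0 < 1 - ε := by linarith
  have hεη : ε * η ≤ ε := by nlinarith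
  have h2 : 1 - ε ≤ 1 - ε * η := by linarith
  have h3 : 1 - ε * η ≤ 1 := by nlinarith
  have hlog1 : Real.log (1 - ε) ≤ Real.log (1 - ε * η) := Real.log_le_log h1 h2
  have hlog2 : Real.log (1 - ε * η) ≤ 0 := Real.log_nonpos (by linarith) h3
  rw [abs_sub_comm, abs_of_nonneg (by linarith)]
  linarith

/-- **Model A (perfect): `τ_int(1_{1}; p, p) = 1/2`.**  With `q = p` every weight is `1`, the
heaviest-state formula `τ_int = w⋆ − 1/2` of `Scoring.tauInt_acfA_mode_eq` gives `1/2` (the chain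
is i.i.d. sampling from the target). -/
theorem tauInt_acfA_parityWitness_self {ε : ℝ} (hε : 0 < ε) (hε1 : ε < 1) :
    tauInt (acfA (![1 - ε, ε] : Fin 2 → ℝ) ![1 - ε, ε] {1}) = 1 / 2 := by
  have hpos := parityWitness_pos hε hε1
  have h := tauInt_acfA_mode_eq (W := 1) (xs := (1 : Fin 2)) hpos (sum_parityWitness ε)
    (fun i => (hpos i).le) (sum_parityWitness ε) (fun i => by rw [one_mul])
    (by rw [one_mul]) (show ε < 1 from hε1)
  rw [h]
  norm_num

/-- **Model B: `τ_int(1_{1}; p, q') = 1/η − 1/2`.**  Under `q' = (1 − εη, εη)` the state `1` is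
the heaviest, with weight `w⋆ = p(1)/q'(1) = 1/η` (the other weight is `(1 − ε)/(1 − εη) ≤ 1`), so
`Scoring.tauInt_acfA_mode_eq` gives `τ_int = 1/η − 1/2` exactly: the population integrated
autocorrelation time of the indicator of the exceptional state is the target-to-model mass ratio on
it, minus one half. -/
theorem tauInt_acfA_parityWitness {ε η : ℝ} (hε : 0 < ε) (hε1 : ε < 1) (hη : 0 < η) (hη1 : η ≤ 1) :
    tauInt (acfA (![1 - ε, ε] : Fin 2 → ℝ) ![1 - ε * η, ε * η] {1}) = 1 / η - 1 / 2 := by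
  have hpos := parityWitness_pos hε hε1
  have hεη0 : 0 < ε * η := mul_pos hε hη
  have hεη1 : ε * η < 1 := by nlinarith
  have hpos' := parityWitness_pos hεη0 hεη1
  have hW : ∀ i, (![1 - ε, ε] : Fin 2 → ℝ) i ≤ η⁻¹ * (![1 - ε * η, ε * η] : Fin 2 → ℝ) i := by
    intro i
    fin_cases i
    · show 1 - ε ≤ η⁻¹ * (1 - ε * η)
      rw [le_inv_mul_iff₀ hη]
      nlinarith
    · show ε ≤ η⁻¹ * (ε * η)
      rw [le_inv_mul_iff₀ hη]
      exact le_of_eq (mul_comm _ _)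
  have hxs : (![1 - ε, ε] : Fin 2 → ℝ) 1 = η⁻¹ * (![1 - ε * η, ε * η] : Fin 2 → ℝ) 1 := by
    show ε = η⁻¹ * (ε * η)
    rw [mul_comm ε η, ← mul_assoc, inv_mul_cancel₀ hη.ne', one_mul]
  have h := tauInt_acfA_mode_eq (W := η⁻¹) (xs := (1 : Fin 2)) hpos (sum_parityWitness ε)
    (fun i => (hpos' i).le) (sum_parityWitness (ε * η)) hW hxs (show ε < 1 from hε1)
  rw [h, one_div η]

/-- **The `τ_int` column has no law in model probability.**  For every `ε ∈ (0, 1)` and every `M`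
there are, on two points, a target `p` and two positive model laws `q = p` and `q'` (probability
vectors) such that: the log-parity defect off the single state `1` is at most `−log(1 − ε)`; that
state has mass `≤ ε` under the target and under both models; `‖q − q'‖_TV ≤ ε` and
`|acc(p, q) − acc(p, q')| ≤ ε`; yet `τ_int` of the indicator of that state is `1/2` under `q` and
at least `M` under `q'`.  (Witness: `p = q = (1 − ε, ε)`, `q' = (1 − εη, εη)` with
`η = min 1 (1/(|M| + 1))`.) [folklore] -/
theorem exists_tauInt_gap_of_logParityOff {ε : ℝ} (hε : 0 < ε) (hε1 : ε < 1) (M : ℝ) :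
    ∃ p q q' : Fin 2 → ℝ, (∀ i, 0 < p i) ∧ (∀ i, 0 < q i) ∧ (∀ i, 0 < q' i) ∧
      ∑ i, p i = 1 ∧ ∑ i, q i = 1 ∧ ∑ i, q' i = 1 ∧ q = p ∧
      |Real.log (q 0) - Real.log (q' 0)| ≤ -Real.log (1 - ε) ∧
      p 1 ≤ ε ∧ q 1 ≤ ε ∧ q' 1 ≤ ε ∧
      tvDist q q' ≤ ε ∧ |accRate p q - accRate p q'| ≤ ε ∧
      tauInt (acfA p q {1}) = 1 / 2 ∧ M ≤ tauInt (acfA p q' {1}) := by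
  set η : ℝ := min 1 (1 / (|M| + 1)) with hηdef
  have hM1 : 0 < |M| + 1 := by positivity
  have hη0 : 0 < η := lt_min one_pos (by positivity)
  have hη1 : η ≤ 1 := min_le_left _ _
  have hηM : η ≤ 1 / (|M| + 1) := min_le_right _ _
  have hpos := parityWitness_pos hε hε1
  have hεη0 : 0 < ε * η := mul_pos hε hη0
  have hεη1 : ε * η < 1 := by nlinarith
  have hpos' := parityWitness_pos hεη0 hεη1
  refine ⟨![1 - ε, ε], ![1 - ε, ε], ![1 - ε * η, ε * η], hpos, hpos, hpos', sum_parityWitness ε,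
    sum_parityWitness ε, sum_parityWitness (ε * η), rfl,
    abs_log_parityWitness_off_le hε.le hε1 hη0.le hη1, ?_, ?_, ?_, ?_, ?_,
    tauInt_acfA_parityWitness_self hε hε1, ?_⟩
  · show ε ≤ ε
    exact le_rfl
  · show ε ≤ ε
    exact le_rfl
  · show ε * η ≤ ε
    nlinarith
  · rw [tvDist_parityWitness hε.le hη1]
    nlinarith
  · rw [accRate_self_eq_one (sum_parityWitness ε), accRate_parityWitness hε.le hη1,
      show (1 : ℝ) - (1 - ε * (1 - η)) = ε * (1 - η) by ring,
      abs_of_nonneg (mul_nonneg hε.le (by linarith))]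
    nlinarith
  · rw [tauInt_acfA_parityWitness hε hε1 hη0 hη1]
    -- `1/η ≥ |M| + 1 ≥ M + 1/2 + 1/2`
    have h1 : |M| + 1 ≤ 1 / η := by
      rw [one_div, le_inv_comm₀ hM1 hη0, ← one_div]
      exact hηM
    have h2 : M ≤ |M| := le_abs_self M
    linarith

end TauInt

end Summit.Ventures.LatticeQCDFlow.Theory2.DensityParity
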